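import Summits.ResolutionOfSingularities.ResolutionOfSingularities.Theorems.WeightedInvariantE2ModelCoverOfMaximal
import Summits.ResolutionOfSingularities.ResolutionOfSingularities.Theorems.WeightedInvariantAssociatedPointIntrinsic
import HarnessLib

/-!
# E2 centre, word (G-6b) `e2CentreHom`: «(a″)» PROVED — the associated points of `Rₙ(W)` of a stalkwise-maximal canonical e = 2 centre are
# MAXIMAL points of `closure (maxLocus₂)` generising read points (no embedded components), for EVERY affine open `W`

Route `ResolutionOfSingularities/WeightedInvariant`, crux `Theses.WeightedInvariant.HypersurfaceCentreConstruction`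
(stmt-ResolutionOfSingularities-19897), door line `local-engine` (skeleton v3.12), E2 tier, registered stub `stub_e2_centre_h`, word (G-6b); status
`Cruxes/HypersurfaceCentreConstruction/G6B-LEMMA-H-STATUS.md`.  …E2CentreHomOfNoEmbedded reduces (G-6b) to «(a″)»; this file proves «(a″)» under the
graded HOM rung, (I0)₂ and (G-0) `E2HomogeneousChartBody` (both inputs of the word) by the LOCAL-MODEL ROUTE:
`Stage.exists_modelCover_piece_ideal_eq` (…E2ModelCoverOfMaximal: the maximal canonical centre IS the glued model, `Rₙ(D(t ℓ)) = 𝒥ₙ(U ℓ, w ℓ)`),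
`primeIdealOf_mem_associatedPrimes_iff_of_mem` (…AssociatedPointIntrinsic: associatedness passes from `W` to the model chart `D(t ℓ) ∋ ξ`),
res-L1-s36's `E2Model.associatedPrimes_quotient_subset_minimalPrimes` (…E2ModelPrimary: `Ass(A ⧸ 𝒥ₙ) ⊆ Min((U))` on a regular weighted chart,
`Stage.hloc_basicOpen`), and `Stage.exists_mem_maxLocus₂_specializes_of_mem_minimalPrimes` (…ELadderTwoCentreChartMaximal: minimal primes of `(U)`
generise read points); maximality in `closure (maxLocus₂)` from minimality over `(U)` and `M ∩ D(t) = V(U)`.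
* `Stage.exists_assPoint_maximal` — «(a″)» as stated in `e2CentreHomBody_of_noEmbedded`'s hypothesis, with `E2HomogeneousChartBody` as extra input.
Def-free helper (`--supports stmt-ResolutionOfSingularities-19897`); nothing here asserts any clause or anything about resolution of singularities in
characteristic `p`; AI-written, weaker than expert review. [OURS · L1 W4.3]
-/

noncomputable section

set_option linter.dupNamespace false -- mandated namespace of this single-conjunct summit
set_option backward.isDefEq.respectTransparency false

open CategoryTheory AlgebraicGeometry TopologicalSpace IsLocalRing Topology
open Literature.AlgebraicGeometry.Resolution
open Summit.ResolutionOfSingularities.ResolutionOfSingularities.Theorems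
open Summit.ResolutionOfSingularities.ResolutionOfSingularities.Theorems.ELadderOne
open Summit.ResolutionOfSingularities.ResolutionOfSingularities.Cruxes.HypersurfaceCentreConstruction.LocalEngine

namespace Summit.ResolutionOfSingularities.ResolutionOfSingularities.Theorems.ELadderOne.Stage

variable {k : Type} [Field k] (S : Stage k) {p : ℕ} (ι : (R : Type) → [CommRing R] → R → Ordinal.{0})
  (J : (R : Type) → [CommRing R] → R → ℕ → Ideal R)

/-- **«(a″)»: NO EMBEDDED ASSOCIATED POINTS.**  Under the graded HOM rung, (I0)₂ and (G-0), for a stalkwise-maximal canonical e = 2 centre `R`,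
an affine open `W`, `n`, and an associated prime `𝔮` of `Γ(W) ⧸ Rₙ(W)`: the point `ξ` of `𝔮` is maximal in `closure (maxLocus₂)` under
generisation and generises a point of `maxLocus₂`. [folklore] -/
theorem exists_assPoint_maximal [CharP k p] [PerfectField k] (hr : PRungGrHomLE 3 p ι J) (h0 : S.InvDim₂)
    (hG0 : E2HomogeneousChartBody p ι J) {R : ReesAlgebraData S.Y} (hR : S.IsCanonicalCentre₂ ι J R)
    (hmaxR : ∀ (n : ℕ) (K : S.Y.IdealSheafData),
      (∀ η ∈ S.maxLocus₂ ι, stalkIdeal K η ≤ J (S.Y.presheaf.stalk η) (localGenerator S.i.ker η) n) → K ≤ R.piece n)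
    (W : S.Y.affineOpens) (n : ℕ) {𝔮 : Ideal Γ(S.Y, W)} (h𝔮 : 𝔮 ∈ associatedPrimes Γ(S.Y, W) (Γ(S.Y, W) ⧸ (R.piece n).ideal W)) :
    ∃ (ξ : S.Y) (hξW : ξ ∈ (W : S.Y.Opens)), (W.2.primeIdealOf ⟨ξ, hξW⟩).asIdeal = 𝔮 ∧
      (∀ y' ∈ closure (S.maxLocus₂ ι), y' ⤳ ξ → ξ ⤳ y') ∧ ∃ η ∈ S.maxLocus₂ ι, ξ ⤳ η := by
  classical
  haveI : IsLocallyNoetherian S.Y := LocallyOfFiniteType.isLocallyNoetherian S.f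
  haveI := S.isNoetherianRing_sections W
  have h𝔮p : 𝔮.IsPrime := IsAssociatedPrime.isPrime h𝔮
  -- the point `ξ` of `𝔮`; `Rₙ(W) ≤ 𝔮`, so `ξ ∈ supp Rₙ ⊆ closure (maxLocus₂)`
  obtain ⟨ξ, hξW, hξ𝔮⟩ := S.exists_primeIdealOf_eq_affine W 𝔮 h𝔮p
  have hI𝔮 : (R.piece n).ideal W ≤ 𝔮 := by
    obtain ⟨-, z, hz⟩ := (isAssociatedPrime_iff.mp h𝔮)
    intro a ha
    rw [hz, Submodule.mem_colon_singleton, Submodule.mem_bot]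
    obtain ⟨z, rfl⟩ := Ideal.Quotient.mk_surjective z
    rw [Algebra.smul_def, Ideal.Quotient.algebraMap_eq, ← map_mul, Ideal.Quotient.eq_zero_iff_mem]
    exact ((R.piece n).ideal W).mul_mem_right _ ha
  have hξsupp : ξ ∈ (R.piece n).support := by
    refine (Scheme.IdealSheafData.mem_support_iff_of_mem (I := R.piece n) (U := W) hξW).mpr ?_
    refine (Scheme.mem_zeroLocus_iff S.Y _ ξ).mpr fun a ha hξa => ?_
    exact (mem_basicOpen_iff_not_mem W hξW a).mp hξa (hξ𝔮 ▸ hI𝔮 ha)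
  have hξM : ξ ∈ closure (S.maxLocus₂ ι) := by
    by_contra h
    have htop := hR.stalkIdeal_eq_top ξ h n
    have hle := (mem_support_iff_stalkIdeal_le (R.piece n) ξ).mp hξsupp
    rw [htop, top_le_iff] at hle
    exact (maximalIdeal.isMaximal (S.Y.presheaf.stalk ξ)).ne_top hle
  -- the model cover of the maximal canonical centre; a chart `D(t ℓ) ∋ ξ`
  obtain ⟨L, _, a, t, N, U, w, ha, hN, hw, hUh, hcov, hS5, hS6, hS3, hmodel⟩ :=
    S.exists_modelCover_piece_ideal_eq ι J hr h0 hG0 hR hmaxR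
  obtain ⟨ℓ, hξt⟩ := Set.mem_iUnion.mp (hcov hξM)
  have hξt' : ξ ∈ (S.Y.affineBasicOpen (t ℓ) : S.Y.Opens) := hξt
  letI := S.atlas.gradedRing (a ℓ)
  haveI := S.isNoetherianRing_sections (S.Y.affineBasicOpen (t ℓ))
  -- the readings (Z)/(M) of the chart
  have hZ : ∀ (y : S.Y) (hy : y ∈ S.Y.basicOpen (t ℓ)),
      (∀ i, (S.Y.presheaf.germ (S.atlas.W (a ℓ)) y (S.Y.basicOpen_le (t ℓ) hy)).hom (U ℓ i) ∈ maximalIdeal (S.Y.presheaf.stalk y)) →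
      y ∈ closure (S.maxLocus₂ ι) := fun y hy hUy =>
    S.mem_closure_maxLocus₂_of_forall_germ_mem ι h0 (ha ℓ) (hN ℓ) (t ℓ) (U ℓ) (hUh ℓ) (hS6 ℓ) hy hUy
  have hM : ∀ (y : S.Y) (hy : y ∈ S.Y.basicOpen (t ℓ)), y ∈ closure (S.maxLocus₂ ι) →
      ∀ i, (S.Y.presheaf.germ (S.atlas.W (a ℓ)) y (S.Y.basicOpen_le (t ℓ) hy)).hom (U ℓ i) ∈ maximalIdeal (S.Y.presheaf.stalk y) :=
    fun y hy hyM => S.forall_germ_mem_of_mem_closure_maxLocus₂ ι (t ℓ) (U ℓ) (hS6 ℓ) hy hyM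
  -- associatedness passes to the model chart, where `Rₙ = 𝒥ₙ(u, w)`
  set u : Fin (N ℓ) → Γ(S.Y, S.Y.affineBasicOpen (t ℓ)) :=
    fun i => (S.Y.presheaf.map (homOfLE (S.Y.basicOpen_le (t ℓ))).op).hom (U ℓ i) with hu
  have hmodel' : (R.piece n).ideal (S.Y.affineBasicOpen (t ℓ)) = weightedMonomialIdeal u (w ℓ) n := by
    rw [hmodel ℓ n, S.map_weightedMonomialIdeal_res (S.Y.basicOpen_le (t ℓ)) (U ℓ) (w ℓ) n]
  have hass' : ((S.Y.affineBasicOpen (t ℓ)).2.primeIdealOf ⟨ξ, hξt'⟩).asIdeal ∈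
      associatedPrimes Γ(S.Y, S.Y.affineBasicOpen (t ℓ)) (Γ(S.Y, S.Y.affineBasicOpen (t ℓ)) ⧸ weightedMonomialIdeal u (w ℓ) n) := by
    rw [← hmodel']
    exact (primeIdealOf_mem_associatedPrimes_iff_of_mem (R.piece n) W (S.Y.affineBasicOpen (t ℓ)) hξW hξt').mp (hξ𝔮 ▸ h𝔮)
  -- hence `𝔭_{D(t)}(ξ)` is a minimal prime of `(u)` (the model has no embedded components)
  have hloc := S.hloc_basicOpen (t ℓ) (U ℓ) (hS3 ℓ) (t ℓ) le_rfl
  have hmin := E2Model.associatedPrimes_quotient_subset_minimalPrimes u (w ℓ) (hw ℓ) hloc n hass'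
  -- generises a read point
  obtain ⟨η, hηM, hηt, hξη⟩ := S.exists_mem_maxLocus₂_specializes_of_mem_minimalPrimes ι (t ℓ) (U ℓ) hZ hM hξt hmin
  refine ⟨ξ, hξW, hξ𝔮, ?_, η, hηM, hξη⟩
  -- maximality in `closure (maxLocus₂)`: a generisation `y'` in `M` lies in `D(t)`, the `U i` vanish at it, minimality of `𝔭(ξ)` over `(u)`
  intro y' hy'M hy'ξ
  have hy't : y' ∈ S.Y.basicOpen (t ℓ) := hy'ξ.mem_open (S.Y.basicOpen (t ℓ)).2 hξt
  have hUy' := hM y' hy't hy'M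
  have hIUy' : Ideal.span (Set.range u) ≤ ((S.Y.affineBasicOpen (t ℓ)).2.primeIdealOf ⟨y', hy't⟩).asIdeal := by
    rw [Ideal.span_le]
    rintro _ ⟨i, rfl⟩
    have h := hUy' i
    rw [← S.germ_map_apply (S.Y.basicOpen_le (t ℓ)) hy't (U ℓ i)] at h
    exact (germ_mem_maximalIdeal_iff_mem (S.Y.affineBasicOpen (t ℓ)) hy't (u i)).mp h
  have hle : ((S.Y.affineBasicOpen (t ℓ)).2.primeIdealOf ⟨y', hy't⟩).asIdeal ≤
      ((S.Y.affineBasicOpen (t ℓ)).2.primeIdealOf ⟨ξ, hξt'⟩).asIdeal :=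
    (S.specializes_iff_primeIdealOf_le_affine (S.Y.affineBasicOpen (t ℓ)) hξt' hy't).mp hy'ξ
  have hge := hmin.2 ⟨((S.Y.affineBasicOpen (t ℓ)).2.primeIdealOf ⟨y', hy't⟩).2, hIUy'⟩ hle
  exact (S.specializes_iff_primeIdealOf_le_affine (S.Y.affineBasicOpen (t ℓ)) hy't hξt').mpr hge

end Summit.ResolutionOfSingularities.ResolutionOfSingularities.Theorems.ELadderOne.Stage

end
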